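/-
Copyright (c) 2026. All rights reserved.
Released under Apache 2.0 license as described in the file LICENSE.
Authors: abc-iut cell, IUT REPAIR / RESCUE-H prover seat abc-iut-rp-d4 (gen 3).
-/
import Literature.IUT.LogVolume.UnitLogValuationProfileNoZeta
import Literature.IUT.LogVolume.UnitLogBoundaryRamificationRoots
import HarnessLib

/-!
# The VALUATION PROFILE of `log_p(𝒪_K^×)`, IV: the BOUNDARY BALL `𝔪^{e/(p−1)} ⊆ log_p(𝒪_K^×)` without `ζ_p`,
# and the complete inner-radius law `𝔪ʳ ⊆ log_p(𝒪_K^×) ⟺ e ≤ r·(p−1)` under (NZ)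

PROOF-ONLY sequel (no `def`, no named fact) of `UnitLogValuationProfile{,Shell,NoZeta}.lean` (abc-iut cell, D-0079 RESCUE-H,
R-H lead's RE-ARM row «rp-d4 → … valuation profile of `log 𝒪^×_{K_w}`, with/without ζ_p»; liaison abc-iut-w4-d036 U2 «inner
conductor»).  Setting: `K` a proper ultrametric normed `ℚ_p`-algebra, `p` ODD, `e = absRamificationIdx p K`, `ϖ` a norm uniformizer,
`L = logUnits K`, hypothesis **(NZ) `∀ X : K, ‖p‖ ≤ ‖X^{p−1} + p‖`** (no `ζ_p` to first order; part III).

* §1 at the tie level `s = e/(p−1)` every term of `L(1 + ϖˢa)` other than the two of indices `1`, `p` lies in `𝔪^{s+1}`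
  (`norm_logTerm_le_zpow_succ_of_level`), whence the **KEY CONGRUENCE** `L(1 + ϖˢ·a) ≡ ϖˢ·(a + c·a^p) (mod 𝔪^{s+1})`,
  `c = ϖ^{s(p−1)}/p` a unit (`norm_logSeries_sub_le_of_level`) — abc-iut-w6-d060's `e = p − 1` congruence at a general level.
* §2 (NZ) ⟹ the additive residue polynomial `ā ↦ ā + c̄·ā^p` has trivial kernel (`norm_lt_one_of_norm_addPoly_lt_one`), hence is
  onto the finite residue field (w6-d060's transfer lemmas BY NAME).
* §3 **`closedBall_pow_subset_logUnits_of_level`**: (NZ), `e = s·(p−1)` ⟹ `𝔪ˢ ⊆ L` (one correction step + the sharp ball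
  `𝔪^{s+1} ⊆ L` of part II) — the inner radius is `e/(p−1)` on the `(p−1) ∣ e` rows, one better than `⌊e/(p−1)⌋ + 1`.
* §4 under (NZ), every `e`: **`closedBall_zpow_subset_logUnits_iff`** `𝔪ʳ ⊆ L ⟺ e ≤ r·(p−1)`; the floor MISS
  `norm_ne_zpow_floor_of_mem_logUnits'`; the SHAPE-OPEN spheres `sphere_meets_not_subset_logUnits'`; and the POS cell
  `mem_pow_smul_logShell_of_le'` (`e ≤ t·(p−1)`, `t = e·ord_p(p*) − m·(n−1)`).

With part III this completes the three-valued profile (IN / MISS / MEETS-PROPERLY) of `log_p(𝒪_K^×)` for every odd `p` and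
every `e` under (NZ); the `ζ_p ∈ K` profile (cancellation cosets at tie levels) is not treated.  Classical `p`-adic analysis
(Washington Lemma 1.4 / §5.1; Neukirch ANT II (5.5)–(5.7)); nothing disputed; no IUT statement asserted; no side taken on
[IUTchIII] Cor. 3.12 or on any author.  References: [cite: Washington1997, Lemma 1.4, §5.1] [cite: NeukirchANT1999, Ch. II Prop. (5.5), (5.7)].
-/

noncomputable section

open Metric Set IsUltrametricDist IsLocalRing
open scoped Pointwise NormedField

namespace Literature.IUT.LogVolume

namespace ValuationProfile

open Literature.NumberTheory.GaloisRepresentations.Ultrametric Literature.NumberTheory.Transcendental RamificationCriterion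
  BoundaryRamification Literature.AnabelianGeometry.AbsoluteAnabelian

variable (p : ℕ) [hp : Fact p.Prime]
variable {K : Type*} [NontriviallyNormedField K] [instK : NormedAlgebra ℚ_[p] K] [IsUltrametricDist K]
  [ProperSpace K]

/-! ### §1. The key congruence at the tie level `s = e/(p−1)` -/

/-- **Term bound at the tie level.**  If `‖x‖ ≤ ‖ϖ‖ˢ` (`s ≥ 1`) and `e = s·(p−1)`, every term of index `n + 1 ∉ {1, p}` of
`L(1 − x)` has norm `≤ ‖ϖ‖^{s+1}` (exponent `s·(n+1) − e·v_p(n+1) ≥ s + 1`: tie arithmetic of part III at `a₀ = 0`).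
[cite: NeukirchANT1999, Ch. II Prop. (5.5)] -/
theorem norm_logTerm_le_zpow_succ_of_level {ϖ : Kˣ} (hϖ : IsUniformizer ϖ) {s : ℕ} (hs : 1 ≤ s)
    (he : absRamificationIdx p K = s * (p - 1)) {x : K} (hx : ‖x‖ ≤ ‖(ϖ : K)‖ ^ s) {n : ℕ} (hn0 : n ≠ 0)
    (hnp : n ≠ p - 1) :
    ‖-(x ^ (n + 1)) / (n + 1 : K)‖ ≤ ‖(ϖ : K)‖ ^ ((s : ℤ) + 1) := by
  have hρ0 : 0 < ‖(ϖ : K)‖ := norm_units_pos ϖ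
  have hρ : ‖(ϖ : K)‖ ≠ 0 := hρ0.ne'
  -- the term norm, bounded by a power of `‖ϖ‖`
  have h1 : ‖-(x ^ (n + 1)) / (n + 1 : K)‖ ≤
      ‖(ϖ : K)‖ ^ ((s : ℤ) * ((n + 1 : ℕ) : ℤ) - (absRamificationIdx p K : ℤ) * (padicValNat p (n + 1) : ℤ)) := by
    have h := LogVolume.norm_logTerm_eq p K (1 - x) n
    rw [sub_sub_cancel] at h
    rw [h]
    calc ‖x‖ ^ (n + 1) * (p : ℝ) ^ padicValNat p (n + 1)
        ≤ (‖(ϖ : K)‖ ^ s) ^ (n + 1) * (p : ℝ) ^ padicValNat p (n + 1) :=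
          mul_le_mul_of_nonneg_right (pow_le_pow_left₀ (norm_nonneg _) hx _) (by positivity)
      _ = ‖(ϖ : K)‖ ^ ((s : ℤ) * ((n + 1 : ℕ) : ℤ) - (absRamificationIdx p K : ℤ) * (padicValNat p (n + 1) : ℤ)) := by
          rw [natCast_prime_pow_eq_zpow p hϖ, ← pow_mul, ← zpow_natCast, ← zpow_add₀ hρ]
          congr 1
  refine h1.trans (zpow_le_zpow_right_of_le_one₀ hρ0 hϖ.1.le ?_)
  -- exponent arithmetic: tie at `a₀ = 0` (`e = s·p⁰·(p−1)`)
  have hs1 : (1 : ℤ) ≤ (s : ℤ) := by exact_mod_cast hs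
  have hE : (1 : ℤ) ≤ (absRamificationIdx p K : ℤ) := by exact_mod_cast absRamificationIdx_pos p K
  have htie : (absRamificationIdx p K : ℤ) = (s : ℤ) * (p : ℤ) ^ 0 * ((p : ℤ) - 1) := by
    rw [he, Nat.cast_mul, Nat.cast_sub hp.out.one_le]
    push_cast
    ring
  obtain ⟨a, ha, ha'⟩ := exists_exponent_le_index (p := p) hs1 (absRamificationIdx p K) (Nat.succ_ne_zero n)
  by_cases ha0 : a = 0
  · subst ha0
    have hne : n + 1 ≠ p ^ 0 := by rw [pow_zero]; omega
    have := ha' hne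
    simp only [pow_zero, mul_one, Nat.cast_zero, mul_zero, sub_zero] at this
    exact this
  by_cases ha1 : a = 1
  · subst ha1
    have hne : n + 1 ≠ p ^ 1 := by rw [pow_one]; have := hp.out.one_le; omega
    have h2 := ha' hne
    push_cast at h2 htie ⊢
    nlinarith [h2, htie]
  · have h3 := exponent_lower_of_tie p hs1 hE (a₀ := 0) (fun a ha ↦ absurd ha (Nat.not_lt_zero a)) htie ha0 ha1
    simp only [pow_zero, mul_one, Nat.cast_zero, mul_zero, sub_zero] at h3
    exact h3.trans ha

/-- `‖ϖ^{s(p−1)}/p‖ = 1` when `e = s·(p−1)`: the coefficient `c` of the key congruence is a unit. [cite: Washington1997, §5.1] -/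
theorem norm_levelCoeff_eq_one {ϖ : Kˣ} (hϖ : IsUniformizer ϖ) {s : ℕ} (he : absRamificationIdx p K = s * (p - 1)) :
    ‖(ϖ : K) ^ (s * (p - 1)) / (p : K)‖ = 1 := by
  rw [norm_div, norm_pow, ← he, norm_pow_absRamificationIdx p K hϖ, norm_prime p K, div_self]
  have : (0 : ℝ) < p := by exact_mod_cast hp.out.pos
  positivity

/-- **KEY CONGRUENCE at the tie level** (`p` odd, `e = s·(p−1)`, `‖a‖ ≤ 1`):
`‖L(1 + ϖˢ·a) − ϖˢ·(a + c·a^p)‖ ≤ ‖ϖ‖^{s+1}`, `c = ϖ^{s(p−1)}/p` — the terms of indices `1` and `p` are `ϖˢa` and `ϖˢ·c·a^p`,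
all others lie in `𝔪^{s+1}`. [cite: Washington1997, §5.1] [cite: NeukirchANT1999, Ch. II Prop. (5.5)] -/
theorem norm_logSeries_sub_le_of_level (hp2 : p ≠ 2) {ϖ : Kˣ} (hϖ : IsUniformizer ϖ) {s : ℕ} (hs : 1 ≤ s)
    (he : absRamificationIdx p K = s * (p - 1)) {a : K} (ha : ‖a‖ ≤ 1) :
    ‖logSeries (1 + (ϖ : K) ^ s * a) - (ϖ : K) ^ s * (a + (ϖ : K) ^ (s * (p - 1)) / (p : K) * a ^ p)‖ ≤
      ‖(ϖ : K)‖ ^ ((s : ℤ) + 1) := by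
  classical
  haveI := IwasawaLog.charZero p (F := K)
  have hρ0 : 0 < ‖(ϖ : K)‖ := norm_units_pos ϖ
  have hp0 : (p : K) ≠ 0 := by exact_mod_cast hp.out.ne_zero
  have hp1 : 1 ≤ p := hp.out.one_le
  set x : K := -((ϖ : K) ^ s * a) with hxdef
  have hx : ‖x‖ ≤ ‖(ϖ : K)‖ ^ s := by
    rw [hxdef, norm_neg, norm_mul, norm_pow]
    exact mul_le_of_le_one_right (by positivity) ha
  have hy : (1 : K) - (1 + (ϖ : K) ^ s * a) = x := by rw [hxdef]; ring
  have hxlt : ‖(1 : K) - (1 + (ϖ : K) ^ s * a)‖ < 1 := by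
    rw [hy]; exact hx.trans_lt (pow_lt_one₀ (norm_nonneg _) hϖ.1 (by omega))
  set f : ℕ → K := fun n ↦ -(((1 : K) - (1 + (ϖ : K) ^ s * a)) ^ (n + 1)) / (n + 1 : K) with hf
  have hsum : HasSum f (logSeries (1 + (ϖ : K) ^ s * a)) := hasSum_logSeries p hxlt
  have hsum₁ := hasSum_ite_sub_hasSum hsum 0
  have hsum₂ := hasSum_ite_sub_hasSum hsum₁ (p - 1)
  have hp10 : p - 1 ≠ 0 := by have := hp.out.two_le; omega
  rw [if_neg hp10] at hsum₂
  -- the two main terms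
  have hodd : Odd p := hp.out.odd_of_ne_two hp2
  have hf0 : f 0 = (ϖ : K) ^ s * a := by
    simp only [hf, hy, hxdef, zero_add, pow_one, Nat.cast_zero, div_one, neg_neg]
  have hfp : f (p - 1) = (ϖ : K) ^ s * ((ϖ : K) ^ (s * (p - 1)) / (p : K) * a ^ p) := by
    have hcast : ((p - 1 : ℕ) : K) + 1 = (p : K) := by rw [Nat.cast_sub hp1, Nat.cast_one, sub_add_cancel]
    have hsp : s * p = s + s * (p - 1) := by
      have h := Nat.sub_add_cancel hp1
      calc s * p = s * (p - 1 + 1) := by rw [h]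
        _ = s + s * (p - 1) := by ring
    simp only [hf, hy]
    rw [hcast, Nat.sub_add_cancel hp1, hxdef, neg_pow, hodd.neg_one_pow, mul_pow, ← pow_mul, hsp, pow_add]
    rw [div_eq_mul_inv, div_eq_mul_inv]
    ring
  have hsplit : logSeries (1 + (ϖ : K) ^ s * a) - (ϖ : K) ^ s * (a + (ϖ : K) ^ (s * (p - 1)) / (p : K) * a ^ p) =
      logSeries (1 + (ϖ : K) ^ s * a) - f 0 - f (p - 1) := by
    rw [hf0, hfp]; ring
  rw [hsplit, ← hsum₂.tsum_eq]
  refine IsUltrametricDist.norm_tsum_le_of_forall_le_of_nonneg (zpow_pos hρ0 _).le fun n ↦ ?_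
  by_cases hnp : n = p - 1
  · rw [if_pos hnp, norm_zero]; exact (zpow_pos hρ0 _).le
  by_cases hn0 : n = 0
  · rw [if_neg hnp, if_pos hn0, norm_zero]; exact (zpow_pos hρ0 _).le
  rw [if_neg hnp, if_neg hn0, hf]
  simp only [hy]
  exact norm_logTerm_le_zpow_succ_of_level p hϖ hs he hx hn0 hnp

/-! ### §2. (NZ) ⟹ the residue polynomial has trivial kernel -/

omit [IsUltrametricDist K] [ProperSpace K] in
/-- **(NZ) ⟹ trivial kernel.**  With `e = s·(p−1)` and `c = ϖ^{s(p−1)}/p`: if `‖a‖ ≤ 1` and `‖a + c·a^p‖ < 1` then `‖a‖ < 1`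
— otherwise `X := ϖˢ·a` has `X^{p−1} + p = p·(c·a^{p−1} + 1)` of norm `< ‖p‖`, against (NZ). [cite: Washington1997, §5.1] -/
theorem norm_lt_one_of_norm_addPoly_lt_one (hNZ : ∀ X : K, ‖(p : K)‖ ≤ ‖X ^ (p - 1) + (p : K)‖) {ϖ : Kˣ}
    {s : ℕ} {a : K} (ha : ‖a‖ ≤ 1) (hΛ : ‖a + (ϖ : K) ^ (s * (p - 1)) / (p : K) * a ^ p‖ < 1) : ‖a‖ < 1 := by
  haveI := IwasawaLog.charZero p (F := K)
  have hp0 : (p : K) ≠ 0 := by exact_mod_cast hp.out.ne_zero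
  have hpn : 0 < ‖(p : K)‖ := norm_pos_iff.mpr hp0
  have hp1 : 1 ≤ p := hp.out.one_le
  refine lt_of_le_of_ne ha fun ha1 ↦ ?_
  have hap : a ^ p = a ^ (p - 1) * a := by rw [← pow_succ, Nat.sub_add_cancel hp1]
  have hfac : a + (ϖ : K) ^ (s * (p - 1)) / (p : K) * a ^ p = a * (1 + (ϖ : K) ^ (s * (p - 1)) / (p : K) * a ^ (p - 1)) := by
    rw [hap]
    ring
  rw [hfac, norm_mul, ha1, one_mul] at hΛ
  have hX := hNZ ((ϖ : K) ^ s * a)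
  have hid : ((ϖ : K) ^ s * a) ^ (p - 1) + (p : K) = (p : K) * (1 + (ϖ : K) ^ (s * (p - 1)) / (p : K) * a ^ (p - 1)) := by
    rw [mul_pow, ← pow_mul]
    field_simp
    ring
  rw [hid, norm_mul] at hX
  have : ‖(p : K)‖ * ‖1 + (ϖ : K) ^ (s * (p - 1)) / (p : K) * a ^ (p - 1)‖ < ‖(p : K)‖ * 1 :=
    mul_lt_mul_of_pos_left hΛ hpn
  rw [mul_one] at this
  exact absurd hX (not_le.mpr this)

/-! ### §3. The boundary ball -/

/-- **THE BOUNDARY BALL.**  `p` odd, `e = s·(p−1)` (`s ≥ 1`), (NZ) ⟹ `{‖z‖ ≤ ‖ϖ‖ˢ} ⊆ log_p(𝒪_K^×)`: the residue polynomial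
`ā ↦ ā + c̄·ā^p` is injective (§2) hence onto the finite residue field (abc-iut-w6-d060's transfer lemmas); for `‖z‖ ≤ ‖ϖ‖ˢ` pick
`a` with `a + c·a^p ≡ z/ϖˢ (mod 𝔪)`, then `z − L(1 + ϖˢa) ∈ 𝔪^{s+1} ⊆ log_p(𝒪^×)` (key congruence + part II's sharp ball), and
`log_p(𝒪^×)` is a group.  Generalises w6-d060's (W1) (`e = p − 1`, `s = 1`). [cite: Washington1997, §5.1] [cite: NeukirchANT1999, Ch. II Prop. (5.7)] -/
theorem closedBall_pow_subset_logUnits_of_level (hp2 : p ≠ 2) (hNZ : ∀ X : K, ‖(p : K)‖ ≤ ‖X ^ (p - 1) + (p : K)‖)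
    {ϖ : Kˣ} (hϖ : IsUniformizer ϖ) {s : ℕ} (hs : 1 ≤ s) (he : absRamificationIdx p K = s * (p - 1)) :
    closedBall (0 : K) (‖(ϖ : K)‖ ^ s) ⊆ logUnits K := by
  intro z hz
  rw [mem_closedBall, dist_zero_right] at hz
  have hρ0 : 0 < ‖(ϖ : K)‖ := norm_units_pos ϖ
  have hϖs0 : (ϖ : K) ^ s ≠ 0 := pow_ne_zero _ ϖ.ne_zero
  have hc1 := norm_levelCoeff_eq_one p hϖ he
  let C : Valued.integer K := ⟨(ϖ : K) ^ (s * (p - 1)) / (p : K), Valued.integer.mem_iff.mpr hc1.le⟩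
  haveI := charP_residueField p K
  haveI : Finite (ResidueField (Valued.integer K)) := finite_residueField
  have hker := addPoly_ker_trivial_of_norm p C (fun a ha hΛ => norm_lt_one_of_norm_addPoly_lt_one p hNZ ha hΛ)
  have hsurj := addPoly_surjective_of_ker p _ hker
  have hb : ‖z / (ϖ : K) ^ s‖ ≤ 1 := by
    rw [norm_div, norm_pow, div_le_one (by positivity)]; exact hz
  obtain ⟨a, ha, hab⟩ := exists_norm_add_mul_pow_sub_lt_one_of_surjective p C hsurj (z / (ϖ : K) ^ s) hb
  -- `‖L(1 + ϖˢ a) − z‖ ≤ ‖ϖ‖^{s+1}`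
  have hL := norm_logSeries_sub_le_of_level p hp2 hϖ hs he ha
  have hab' : ‖(ϖ : K) ^ s * ((a + (C : K) * a ^ p) - z / (ϖ : K) ^ s)‖ ≤ ‖(ϖ : K)‖ ^ ((s : ℤ) + 1) := by
    rw [norm_mul, norm_pow, zpow_add_one₀ hρ0.ne', zpow_natCast]
    refine mul_le_mul_of_nonneg_left (hϖ.norm_le_of_norm_lt_one _ ?_) (by positivity)
    have : a + (C : K) * a ^ p - z / (ϖ : K) ^ s = a + (ϖ : K) ^ (s * (p - 1)) / (p : K) * a ^ p - z / (ϖ : K) ^ s := rfl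
    rw [this]
    exact hab
  have hdiff : ‖logSeries (1 + (ϖ : K) ^ s * a) - z‖ ≤ ‖(ϖ : K)‖ ^ ((s : ℤ) + 1) := by
    have hsplit : logSeries (1 + (ϖ : K) ^ s * a) - z =
        (logSeries (1 + (ϖ : K) ^ s * a) - (ϖ : K) ^ s * (a + (ϖ : K) ^ (s * (p - 1)) / (p : K) * a ^ p)) +
          (ϖ : K) ^ s * ((a + (C : K) * a ^ p) - z / (ϖ : K) ^ s) := by
      have : (C : K) = (ϖ : K) ^ (s * (p - 1)) / (p : K) := rfl
      rw [this, mul_sub, mul_div_cancel₀ _ hϖs0]; ring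
    rw [hsplit]
    exact (norm_add_le_max _ _).trans (max_le hL hab')
  -- `z − L(y) ∈ 𝔪^{s+1} ⊆ log_p(𝒪^×)` (part II's sharp ball: `e = s(p−1) < (s+1)(p−1)`)
  have hlt : (absRamificationIdx p K : ℤ) < ((s : ℤ) + 1) * ((p : ℤ) - 1) := by
    rw [he, Nat.cast_mul, Nat.cast_sub hp.out.one_le, Nat.cast_one]
    have : (0 : ℤ) < (p : ℤ) - 1 := by have := hp.out.two_le; omega
    linarith
  have h1 : z - logSeries (1 + (ϖ : K) ^ s * a) ∈ logUnits K :=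
    closedBall_zpow_subset_logUnits_of_lt p hϖ hlt (by rw [mem_closedBall, dist_zero_right, norm_sub_rev]; exact hdiff)
  have hyP : IsPrincipal (1 + (ϖ : K) ^ s * a) := by
    rw [IsPrincipal, sub_add_cancel_left, norm_neg, norm_mul, norm_pow]
    exact (mul_le_of_le_one_right (by positivity) ha).trans_lt (pow_lt_one₀ (norm_nonneg _) hϖ.1 (by omega))
  have h2 : logSeries (1 + (ϖ : K) ^ s * a) ∈ logUnits K := by
    rw [← unitLog_of_isPrincipal p hyP]; exact unitLog_mem_logUnits hyP.norm_eq_one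
  have h3 := (logUnitsAddSubgroup p K).add_mem h1 h2
  rwa [sub_add_cancel] at h3

/-! ### §4. The complete inner-radius law under (NZ), and the cells -/

/-- **INNER-RADIUS LAW under (NZ), `p` odd: `{‖z‖ ≤ ‖ϖ‖ʳ} ⊆ log_p(𝒪_K^×)` whenever `e ≤ r·(p−1)`** (strict: part II's sharp
ball, every `e`; equality: the boundary ball of §3). [cite: NeukirchANT1999, Ch. II Prop. (5.7)] [cite: Washington1997, §5.1] -/
theorem closedBall_zpow_subset_logUnits_of_le' (hp2 : p ≠ 2) (hNZ : ∀ X : K, ‖(p : K)‖ ≤ ‖X ^ (p - 1) + (p : K)‖)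
    {ϖ : Kˣ} (hϖ : IsUniformizer ϖ) {r : ℤ} (hr : (absRamificationIdx p K : ℤ) ≤ r * ((p : ℤ) - 1)) :
    closedBall (0 : K) (‖(ϖ : K)‖ ^ r) ⊆ logUnits K := by
  rcases hr.lt_or_eq with hlt | heq
  · exact closedBall_zpow_subset_logUnits_of_lt p hϖ hlt
  · have hp1 : (0 : ℤ) < (p : ℤ) - 1 := by have := hp.out.two_le; omega
    have he1 : (1 : ℤ) ≤ (absRamificationIdx p K : ℤ) := by exact_mod_cast absRamificationIdx_pos p K
    have hr0 : 0 < r := by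
      by_contra h
      have : r * ((p : ℤ) - 1) ≤ 0 := mul_nonpos_of_nonpos_of_nonneg (not_lt.mp h) hp1.le
      linarith
    obtain ⟨s, rfl⟩ : ∃ s : ℕ, r = (s : ℤ) := ⟨r.toNat, (Int.toNat_of_nonneg hr0.le).symm⟩
    have hs : 1 ≤ s := by exact_mod_cast hr0
    have he : absRamificationIdx p K = s * (p - 1) := by
      have h2 : ((absRamificationIdx p K : ℕ) : ℤ) = ((s * (p - 1) : ℕ) : ℤ) := by
        rw [heq, Nat.cast_mul, Nat.cast_sub hp.out.one_le, Nat.cast_one]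
      exact_mod_cast h2
    rw [zpow_natCast]
    exact closedBall_pow_subset_logUnits_of_level p hp2 hNZ hϖ hs he

/-- **The floor MISS under (NZ)** (every `e`): with `r₁·(p−1) < e ≤ (r₁+1)·(p−1)` (so `r₁ = ⌈e/(p−1)⌉ − 1`), no log-unit has
norm `‖ϖ‖^{r₁}` — gap between `h_{r₁}(1) < r₁` and `ν(r₁+1) = r₁ + 1` (part III's gap theorem), or the floor of part I when `r₁ ≤ 0`.
[cite: NeukirchANT1999, Ch. II Prop. (5.5)] -/
theorem norm_ne_zpow_floor_of_mem_logUnits' (hNZ : ∀ X : K, ‖(p : K)‖ ≤ ‖X ^ (p - 1) + (p : K)‖) {ϖ : Kˣ}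
    (hϖ : IsUniformizer ϖ) {r₁ : ℤ} (hr : r₁ * ((p : ℤ) - 1) < absRamificationIdx p K)
    (hr' : (absRamificationIdx p K : ℤ) ≤ (r₁ + 1) * ((p : ℤ) - 1))
    {z : K} (hz : z ∈ logUnits K) : ‖z‖ ≠ ‖(ϖ : K)‖ ^ r₁ := by
  rcases le_or_gt 1 r₁ with hr1 | hr0
  · refine norm_ne_zpow_of_mem_logUnits_of_gap' p hNZ hϖ hr1 (a₀ := 1) (a₁ := 0) ?_ (fun a ha ↦ ?_) ?_ ?_ hz
    · rw [pow_one]; push_cast; linarith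
    · omega
    · simpa using hr'
    · simp
  · refine norm_ne_zpow_of_mem_logUnits_of_lt_min p hϖ (a₀ := 0) (fun a ha ↦ ?_) ?_ ?_ hz
    · omega
    · have hp1 : (0 : ℤ) ≤ (p : ℤ) - 1 := by have := hp.out.two_le; omega
      have : (r₁ + 1) * ((p : ℤ) - 1) ≤ 1 * ((p : ℤ) - 1) := mul_le_mul_of_nonneg_right (by omega) hp1
      simpa using (hr'.trans this)
    · simp; omega

/-- **Sharpness under (NZ)**: `r·(p−1) < e` ⟹ `{‖z‖ ≤ ‖ϖ‖ʳ} ⊄ log_p(𝒪_K^×)` (the ball contains the floor MISS sphere of exponent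
`⌈e/(p−1)⌉ − 1`). [cite: NeukirchANT1999, Ch. II Prop. (5.5)] -/
theorem not_closedBall_zpow_subset_logUnits_of_mul_lt' (hNZ : ∀ X : K, ‖(p : K)‖ ≤ ‖X ^ (p - 1) + (p : K)‖) {ϖ : Kˣ}
    (hϖ : IsUniformizer ϖ) {r : ℤ} (hr : r * ((p : ℤ) - 1) < absRamificationIdx p K) :
    ¬ closedBall (0 : K) (‖(ϖ : K)‖ ^ r) ⊆ logUnits K := by
  intro hsub
  have hρ0 : 0 < ‖(ϖ : K)‖ := norm_units_pos ϖ
  have he1 : 1 ≤ absRamificationIdx p K := absRamificationIdx_pos p K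
  have hp1 : 0 < p - 1 := by have := hp.out.two_le; omega
  -- `r₁ := (e − 1)/(p − 1)`: `r₁·(p−1) ≤ e − 1 < e ≤ (r₁+1)·(p−1)`
  obtain ⟨r₁, hr₁⟩ : ∃ r₁ : ℕ, r₁ = (absRamificationIdx p K - 1) / (p - 1) := ⟨_, rfl⟩
  have hcast : ((p - 1 : ℕ) : ℤ) = (p : ℤ) - 1 := by rw [Nat.cast_sub hp.out.one_le, Nat.cast_one]
  have hmod := Nat.div_add_mod (absRamificationIdx p K - 1) (p - 1)
  have hmodlt := Nat.mod_lt (absRamificationIdx p K - 1) hp1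
  rw [← hr₁] at hmod
  have hlowN : r₁ * (p - 1) < absRamificationIdx p K := by
    rw [mul_comm]; omega
  have hupN : absRamificationIdx p K ≤ (r₁ + 1) * (p - 1) := by
    rw [add_mul, one_mul, mul_comm]; omega
  have hlow : (r₁ : ℤ) * ((p : ℤ) - 1) < absRamificationIdx p K := by
    rw [← hcast]; exact_mod_cast hlowN
  have hup : (absRamificationIdx p K : ℤ) ≤ ((r₁ : ℤ) + 1) * ((p : ℤ) - 1) := by
    rw [← hcast]; exact_mod_cast hupN
  have hrle : r ≤ (r₁ : ℤ) := by
    by_contra hlt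
    have hlt : (r₁ : ℤ) + 1 ≤ r := by omega
    have hp1' : (0 : ℤ) ≤ (p : ℤ) - 1 := by have := hp.out.two_le; omega
    have : ((r₁ : ℤ) + 1) * ((p : ℤ) - 1) ≤ r * ((p : ℤ) - 1) := mul_le_mul_of_nonneg_right hlt hp1'
    linarith
  have hmem : (ϖ : K) ^ (r₁ : ℤ) ∈ closedBall (0 : K) (‖(ϖ : K)‖ ^ r) := by
    rw [mem_closedBall, dist_zero_right, norm_zpow]
    exact zpow_le_zpow_right_of_le_one₀ hρ0 hϖ.1.le hrle
  exact norm_ne_zpow_floor_of_mem_logUnits' p hNZ hϖ hlow hup (hsub hmem) (norm_zpow _ _)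

/-- **`{‖z‖ ≤ ‖ϖ‖ʳ} ⊆ log_p(𝒪_K^×) ⟺ e ≤ r·(p−1)`** for odd `p` under (NZ) — the complete inner-radius law (inner conductor
`⌈e/(p−1)⌉`, abc-iut-w4-d036's U2 question, in the absence of `ζ_p`). [cite: NeukirchANT1999, Ch. II Prop. (5.7)] [cite: Washington1997, §5.1] -/
theorem closedBall_zpow_subset_logUnits_iff (hp2 : p ≠ 2) (hNZ : ∀ X : K, ‖(p : K)‖ ≤ ‖X ^ (p - 1) + (p : K)‖)
    {ϖ : Kˣ} (hϖ : IsUniformizer ϖ) (r : ℤ) :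
    closedBall (0 : K) (‖(ϖ : K)‖ ^ r) ⊆ logUnits K ↔ (absRamificationIdx p K : ℤ) ≤ r * ((p : ℤ) - 1) :=
  ⟨fun h ↦ not_lt.mp fun hlt ↦ not_closedBall_zpow_subset_logUnits_of_mul_lt' p hNZ hϖ hlt h,
    closedBall_zpow_subset_logUnits_of_le' p hp2 hNZ hϖ⟩

/-- **The SHAPE-OPEN spheres under (NZ)** (every `e`): at `t = ν(s) = s·p^{a₀} − e·a₀` with `a₀ ≥ 1` (non-strict turning point of
`s`) the sphere `{‖z‖ = ‖ϖ‖ᵗ}` MEETS `log_p(𝒪_K^×)` but is NOT contained in it. [cite: NeukirchANT1999, Ch. II Prop. (5.5)] -/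
theorem sphere_meets_not_subset_logUnits' (hNZ : ∀ X : K, ‖(p : K)‖ ≤ ‖X ^ (p - 1) + (p : K)‖) {ϖ : Kˣ}
    (hϖ : IsUniformizer ϖ) {s : ℕ} (hs : 1 ≤ s) {a₀ : ℕ} (ha₀ : a₀ ≠ 0)
    (hlo : ∀ a < a₀, (s : ℤ) * (p : ℤ) ^ a * ((p : ℤ) - 1) < absRamificationIdx p K)
    (hhi : (absRamificationIdx p K : ℤ) ≤ (s : ℤ) * (p : ℤ) ^ a₀ * ((p : ℤ) - 1)) :
    (∃ z ∈ logUnits K, ‖z‖ = ‖(ϖ : K)‖ ^ ((s : ℤ) * (p : ℤ) ^ a₀ - (absRamificationIdx p K : ℤ) * (a₀ : ℤ))) ∧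
    ¬ {z : K | ‖z‖ = ‖(ϖ : K)‖ ^ ((s : ℤ) * (p : ℤ) ^ a₀ - (absRamificationIdx p K : ℤ) * (a₀ : ℤ))}
        ⊆ logUnits K := by
  have hu : ‖1 - (ϖ : K) ^ s‖ = 1 := by
    have hyP : IsPrincipal (1 - (ϖ : K) ^ s) := by
      rw [isPrincipal_iff, sub_sub_cancel, norm_pow]
      exact pow_lt_one₀ (norm_nonneg _) hϖ.1 (by omega)
    exact hyP.norm_eq_one
  refine ⟨⟨unitLog (1 - (ϖ : K) ^ s), unitLog_mem_logUnits hu, norm_unitLog_one_sub_pow_of_turning p hNZ hϖ hs hlo hhi⟩,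
    fun hsub ↦ ?_⟩
  have hball := closedBall_subset_logUnits_of_sphere_subset p hsub
  refine not_closedBall_zpow_subset_logUnits_of_mul_lt' p hNZ hϖ ?_ hball
  have hle := turningValue_add_le p (a₀ := a₀) hlo
  have h0 := hlo 0 (Nat.pos_of_ne_zero ha₀)
  simp only [pow_zero, mul_one] at h0
  have ha1 : (1 : ℤ) ≤ (a₀ : ℤ) := by exact_mod_cast Nat.one_le_iff_ne_zero.mpr ha₀
  have hp1' : (0 : ℤ) < (p : ℤ) - 1 := by have := hp.out.two_le; omega
  rcases le_or_gt 0 ((s : ℤ) * (p : ℤ) ^ a₀ - (absRamificationIdx p K : ℤ) * (a₀ : ℤ)) with ht0 | ht0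
  · calc ((s : ℤ) * (p : ℤ) ^ a₀ - (absRamificationIdx p K : ℤ) * (a₀ : ℤ)) * ((p : ℤ) - 1)
        ≤ ((s : ℤ) - 1) * ((p : ℤ) - 1) := mul_le_mul_of_nonneg_right (by linarith) hp1'.le
      _ < absRamificationIdx p K := by nlinarith
  · calc ((s : ℤ) * (p : ℤ) ^ a₀ - (absRamificationIdx p K : ℤ) * (a₀ : ℤ)) * ((p : ℤ) - 1)
        < 0 := mul_neg_of_neg_of_pos ht0 hp1'
      _ ≤ absRamificationIdx p K := by positivity

/-- **DECIDED-POS cell under (NZ), `p` odd: `‖q‖ = ‖ϖ‖ᵐ` and `e ≤ (e·ord_p(p*) − m·(n−1))·(p−1)` ⟹ `q ∈ qⁿ·ℐ_K`** — with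
`≤` in place of part II's `<`: one unit better on the `(p−1) ∣ e` rows. [cite: Washington1997, §5.1] [cite: MochizukiAbsTopIII2015, Def 5.4 (iii) p. 126] -/
theorem mem_pow_smul_logShell_of_le' (hp2 : p ≠ 2) (hNZ : ∀ X : K, ‖(p : K)‖ ≤ ‖X ^ (p - 1) + (p : K)‖) {ϖ : Kˣ}
    (hϖ : IsUniformizer ϖ) {q : K} (hq : q ≠ 0) {m : ℤ} (hqm : ‖q‖ = ‖(ϖ : K)‖ ^ m) {n : ℕ}
    (h : (absRamificationIdx p K : ℤ) ≤
      ((absRamificationIdx p K : ℤ) * ((if p = 2 then 2 else 1 : ℕ) : ℤ) - m * ((n : ℤ) - 1)) * ((p : ℤ) - 1)) :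
    q ∈ q ^ n • Literature.AnabelianGeometry.AbsoluteAnabelian.logShell (PadicLogOnUnits.ofUnitLog p K) := by
  rw [mem_pow_smul_logShell_iff p hq]
  apply closedBall_zpow_subset_logUnits_of_le' p hp2 hNZ hϖ h
  rw [mem_closedBall, dist_zero_right, norm_pstar_mul_eq_zpow p hϖ hqm n]

end ValuationProfile

end Literature.IUT.LogVolume

end

-- tree-health (abc-iut-w6-d081 g5, 2026-08-26T19:03Z): comment-only re-land of a STRANDED ACCEPT (p459645; serial farm import probe at 19:01Z answers rc 75 «remote:stale:35:unbuilt», ≥ 65 min);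
-- declarations byte-identical to the accepted version; purpose = trigger the rebuild (rule of record: a re-land outside a reload window is served in 10–27 min). No content change.
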